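import Literature.AnabelianGeometry.SemiGraphs.TemperedReconstruction
import Literature.AnabelianGeometry.SemiGraphs.TemperedCoveringsComponents
import HarnessLib

/-!
# A covering object with connected covering semi-graph is a connected object of `B^temp(G)`

Mochizuki, *Semi-graphs of anabelioids*, Publ. RIMS **42** (2006), §3, Def. 3.5 (i)–(ii) p. 37 ("we may
associate, in a natural way, to any object of `B^cov(G)` a morphism of countable semi-graphs of
anabelioids `G' → G`"; connected objects = connected coverings) [cite: MochizukiSemiAnbd2006, Def 3.5(i)
p.37].  For `S ∈ B^cov(G)` with covering semi-graph `G_S` (`CovObj.coveringSemiGraph`: vertices and edges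
are the orbits of the fibres, incidence by the gluing), connectedness of the underlying semi-graph of
`G_S` (the barycentric subdivision `SemiGraph.subdivision` is a connected simple graph) implies that
all points of `S` lie in one component (`CovObj.SameComponent`), hence — if `S` is tempered — that `S`
is a CONNECTED object of `B^temp(G)` (`isConnectedObj_of_sameComponent`).  In particular the hypothesis
"`S` connected" of the route-T transfer theorems (`CovObj.compactInVerticialAt_coveringGraph` &c.) is
implied by the antecedent `Thm37Hypotheses` of the transferred statement.  Proof-only (abc-iut cell,
L3 route T, brick T5); nothing here bears on [IUTchIII] Cor. 3.12.
-/

namespace Literature.AnabelianGeometry.SemiGraphs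

namespace ProfiniteSemiGraph

namespace CovObj

open Literature.AlgebraicGeometry.Frobenioids (IsConnectedObj)

universe u

variable {𝒢 : ProfiniteSemiGraph.{u}} (S : CovObj 𝒢)

/-- Two points in one orbit of a vertex fibre lie in one component. [cite: MochizukiSemiAnbd2006, Def 3.5(ii) p.37] -/
theorem sameComponent_of_cl_eq {v : 𝒢.graph.Vertex} {x y : (S.SV v).obj.V}
    (h : BTemp.cl (S.SV v) x = BTemp.cl (S.SV v) y) :
    S.SameComponent (Sum.inl ⟨v, x⟩) (Sum.inl ⟨v, y⟩) := by
  obtain ⟨g, rfl⟩ := (BTemp.cl_eq_cl_iff _ _ _).mp h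
  exact Relation.EqvGen.rel _ _ (CovObj.Adj.vertex v g x)

/-- Two points in one orbit of an edge fibre lie in one component. [cite: MochizukiSemiAnbd2006, Def 3.5(ii) p.37] -/
theorem sameComponent_of_cl_eq_edge {e : 𝒢.graph.Edge} {x y : (S.SE e).obj.V}
    (h : BTemp.cl (S.SE e) x = BTemp.cl (S.SE e) y) :
    S.SameComponent (Sum.inr ⟨e, x⟩) (Sum.inr ⟨e, y⟩) := by
  obtain ⟨g, rfl⟩ := (BTemp.cl_eq_cl_iff _ _ _).mp h
  exact Relation.EqvGen.rel _ _ (CovObj.Adj.edge e g x)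

/-- **Connected covering semi-graph ⇒ one component**: if the underlying semi-graph of `G_S` is
connected, any two points of `S` lie in the same connected component.
[cite: MochizukiSemiAnbd2006, Def 3.5(ii) p.37] -/
theorem sameComponent_of_isConnected_coveringSemiGraph (hc : S.coveringSemiGraph.IsConnected)
    (p q : S.Point) : S.SameComponent p q := by
  classical
  -- base point under a node
  let P : S.coveringSemiGraph.Node → S.Point := fun n =>
    match n with
    | Sum.inl ⟨v, ω⟩ => Sum.inl ⟨v, Quot.out ω⟩
    | Sum.inr (Sum.inl ⟨e, ω⟩) => Sum.inr ⟨e, Quot.out ω⟩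
    | Sum.inr (Sum.inr ⟨b, ω⟩) => Sum.inr ⟨𝒢.graph.edgeOf b, Quot.out ω⟩
  -- incident nodes have base points in one component
  have hrel : ∀ n n' : S.coveringSemiGraph.Node, S.coveringSemiGraph.NodeRel n n' →
      S.SameComponent (P n) (P n') := by
    intro n n' h
    cases h with
    | edge_branch b' =>
      obtain ⟨b, ω⟩ := b'
      exact Relation.EqvGen.refl _
    | branch_vertex b' v' h =>
      obtain ⟨b, ω⟩ := b'
      obtain ⟨v, ωv⟩ := v'
      have hb : 𝒢.graph.abuts b = some v := S.abuts_of_coveringAbuts h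
      obtain ⟨g, hg⟩ := S.exists_conjugator h
      refine Relation.EqvGen.trans _ _ _
        (Relation.EqvGen.rel _ _ (CovObj.Adj.glue b v hb (Quot.out ω))) ?_
      have := Relation.EqvGen.rel _ _
        (CovObj.Adj.vertex (S := S) v g ((S.glue b v hb).hom.hom.hom (Quot.out ω)))
      rw [hg] at this
      exact this
  have hadj : ∀ n n' : S.coveringSemiGraph.Node, S.coveringSemiGraph.subdivision.Adj n n' →
      S.SameComponent (P n) (P n') := by
    intro n n' h
    rw [SemiGraph.subdivision, SimpleGraph.fromRel_adj] at h
    rcases h.2 with h' | h'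
    · exact hrel n n' h'
    · exact Relation.EqvGen.symm _ _ (hrel n' n h')
  have hreach : ∀ n n' : S.coveringSemiGraph.Node, S.SameComponent (P n) (P n') := by
    intro n n'
    obtain ⟨w⟩ := hc.connected.preconnected n n'
    induction w with
    | nil => exact Relation.EqvGen.refl _
    | cons h _ ih => exact Relation.EqvGen.trans _ _ _ (hadj _ _ h) ih
  -- every point lies in the component of the base point of its node
  have hpt : ∀ p : S.Point, ∃ n, S.SameComponent (P n) p := by
    rintro (⟨v, x⟩ | ⟨e, x⟩)
    · exact ⟨Sum.inl ⟨v, BTemp.cl (S.SV v) x⟩, S.sameComponent_of_cl_eq (Quot.out_eq _)⟩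
    · exact ⟨Sum.inr (Sum.inl ⟨e, BTemp.cl (S.SE e) x⟩), S.sameComponent_of_cl_eq_edge (Quot.out_eq _)⟩
  obtain ⟨n, hn⟩ := hpt p
  obtain ⟨n', hn'⟩ := hpt q
  exact Relation.EqvGen.trans _ _ _ (Relation.EqvGen.trans _ _ _ (Relation.EqvGen.symm _ _ hn)
    (hreach n n')) hn'

/-- **A tempered `S` whose covering semi-graph of anabelioids `G_S` is connected and has a vertex is a
connected object of `B^temp(G)`.** In particular this holds under `Thm37Hypotheses G_S`.
[cite: MochizukiSemiAnbd2006, Def 3.5(ii) p.37] -/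
theorem isConnectedObj_of_isConnected_coveringGraph (hS : S.IsTempered)
    (hc : S.coveringGraph.IsConnected) (hv : S.coveringGraph.HasVertex) :
    IsConnectedObj (⟨S, hS⟩ : BTempCat 𝒢) := by
  obtain ⟨⟨v, ω⟩⟩ := hv
  exact isConnectedObj_of_sameComponent ⟨S, hS⟩ (Sum.inl ⟨v, Quot.out ω⟩)
    (fun q => S.sameComponent_of_isConnected_coveringSemiGraph hc _ q)

/-- The same from the standing hypotheses of Theorem 3.7 for `G_S`. [cite: MochizukiSemiAnbd2006, Thm 3.7 p.40] -/
theorem isConnectedObj_of_thm37Hypotheses_coveringGraph (hS : S.IsTempered)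
    (h : S.coveringGraph.Thm37Hypotheses) : IsConnectedObj (⟨S, hS⟩ : BTempCat 𝒢) :=
  S.isConnectedObj_of_isConnected_coveringGraph hS h.isConnected h.hasVertex

end CovObj

end ProfiniteSemiGraph

end Literature.AnabelianGeometry.SemiGraphs
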